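import Summits.BirchSwinnertonDyer.BirchSwinnertonDyer.Theorems.BiquadraticEisensteinDescentEisensteinHeartFlatCMInertBadKPrimeDeuringOverKPrime
import Literature.NumberTheory.EllipticCurves.RankinSelbergValueHeckeShiftedContinuationProofs
import Literature.NumberTheory.AdelicBaseChange.IdeleNormModule
import HarnessLib

set_option linter.dupNamespace false -- `Summit.BirchSwinnertonDyer.BirchSwinnertonDyer.Theorems.…` (summit = sub)
set_option autoImplicit false

/-!
# Crux `EisensteinHeartFlatCMInertBadKPrime` (stmt-BirchSwinnertonDyer-21341), line `hsieh-lambda`, layer 2 (V2):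
# hypothesis (L) of the Katz–Hsieh socket DISCHARGED to Deuring's theorem over `ℚ` + the socket's own (T)

Route `BiquadraticEisensteinDescent` (cell `pub/bsd-wall`, width seat `bsd-wall-cm-bed-w3`). THEOREMS ONLY (no definition,
no named fact, no `sorry`); supports stmt-BirchSwinnertonDyer-21341 as a helper; nothing about the crux's input or any case
of BSD is asserted.

## What is proved

`hLval_of_deuring` — the hypothesis `hLval` of `…KatzHsiehDisplay.exists_span_C_mul_eq` /
`…KatzHsiehSocket.exists_isBaseChangeLine_span_C_mul_eq` IN ITS LITERAL SHAPE, with `c_L = c_L′ = 1`, for the branch character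
`λ = (ψ ∘ N_{L/K_CM}) · ν` (`ν(x) = ‖x‖`, i.e. `λ = ψ_L · N_L⁻¹`):

  `∀ χ n, 0 < n → χ unramified → χ.HasInfinityType (n) (−n) →
     ∀ hL : HasEntireContinuation (heckeLFunction (λ · χ∘N_{L/K′})), hL.continuation 0 = 1 · 1ⁿ · rankinSelbergValueHecke f χ 1`

from: the socket's hypothesis (T) (`hT`, Katz type `k = 1` of `λ · χ∘N` — consumed, not proved); a Hecke character `ψ` of the
CM field `K₁` of infinity type `(1, 0)` satisfying Deuring's local clause (iv) at the good primes (the clauses (i), (iv) of the named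
fact `Deuring_exists_heckeCharacter_of_maximalCM`, taken as hypotheses on `ψ`); `η = ψ ∘ N` ramified above the bad primes;
`f` the newform of the CM curve `W`; the biquadratic frame `L ⊇ K′, K₁` (`τ ∈ Gal(L/K′)` acting on `K₁` as `c`) with its two
splitting side conditions (`hdeg`, `hramL` of `…DeuringOverKPrime.polynomial_identity`). Assembly of
`hLval_of_hasKatzType_of_heckeLFunction_eq` (Tate continuation + shift, `RankinSelbergValueHeckeShiftedContinuationProofs`),
`hEP_of_polynomial_identities'` (Euler products regrouped along `L/K′`, `RankinSelbergEulerProductHeckeInducedAllPlacesProofs`) and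
`…DeuringOverKPrime.polynomial_identity` (Deuring over `K′`).

Also: `norm_compRelNorm_apply` (the exponent of `ψ ∘ N_{L/K₁}` is that of `ψ`, `‖N y‖_{K₁} = ‖y‖_L`) and
`norm_apply_eq_rpow_of_hasInfinityType_one_zero` (type `(1,0)` ⇒ exponent `−1/2`).

References: [SilvermanATAEC1994] Ch. II Thm. 9.2, 10.5 (b), Ex. 2.30–2.32; [Hsieh2014mu] Prop. 4.9 (§4.8); [Castella2018] Thm. 3.1;
[TateThesis1967] Thm. 4.4.1; [WeilBNT1967] Ch. IV §3, Ch. VII §3.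
-/

noncomputable section

open scoped NumberField
open NumberField IsDedekindDomain Complex CongruenceSubgroup WeierstrassCurve
open Literature.NumberTheory.GaloisRepresentations Literature.NumberTheory.EllipticCurves
open Literature.NumberTheory.EllipticCurves.ModularForms Literature.NumberTheory.AdelicBaseChange
open Summit.BirchSwinnertonDyer.BirchSwinnertonDyer.Theorems.BiquadraticEisensteinDescentEisensteinHeartFlatCMInertBadKPrimeDeuringOverKPrime

namespace Summit.BirchSwinnertonDyer.BirchSwinnertonDyer.Theorems.BiquadraticEisensteinDescentEisensteinHeartFlatCMInertBadKPrimeKatzHsiehLValue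

variable {K₁ K L : Type} [Field K₁] [NumberField K₁] [Field K] [NumberField K] [Field L] [NumberField L]
  [Algebra K₁ L] [IsGalois K₁ L] [Algebra K L] [IsGalois K L]

/-- **The exponent of `ψ ∘ N_{L/K₁}` is that of `ψ`**: `‖ψ(N y)‖ = ‖N y‖_{K₁}^σ = ‖y‖_L^σ` (the module of a norm,
`ideleNorm_automorphic_ideleRelNorm`). [cite: WeilBNT1967, Ch. IV §3, Corollary of Proposition 3] -/
theorem norm_compRelNorm_apply (ψ : HeckeCharacter K₁) {σ : ℝ}
    (hψσ : ∀ x : ideleGroup K₁, ‖((ψ x : ℂˣ) : ℂ)‖ = ideleNorm x ^ σ) (y : ideleGroup L) :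
    ‖(((ψ.compRelNorm L) y : ℂˣ) : ℂ)‖ = ideleNorm y ^ σ := by
  rw [HeckeCharacter.compRelNorm_apply, hψσ, ← Literature.NumberTheory.Automorphic.coe_ideleNorm,
    ← Literature.NumberTheory.Automorphic.coe_ideleNorm, ideleNorm_automorphic_ideleRelNorm]

omit [Algebra K₁ L] [IsGalois K₁ L] [NumberField L] [Field L] in
/-- **Infinity type `(1, 0)` ⇒ exponent `−1/2`** (`2σ = −(1 + 0)`; `K₁` totally complex): `‖ψ(x)‖ = ‖x‖^{−1/2}`, i.e.
`|ψ(ϖ)| = N(ϖ)^{1/2}` (weight `2`). [cite: SilvermanATAEC1994, Ch. II Thm. 9.2 (proof, p. 165)] [cite: Weil1956, §1] -/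
theorem norm_apply_eq_rpow_of_hasInfinityType_one_zero [IsTotallyComplex K₁] {ψ : HeckeCharacter K₁}
    (h : ψ.HasInfinityType (fun _ ↦ 1) (fun _ ↦ 0)) (x : ideleGroup K₁) :
    ‖((ψ x : ℂˣ) : ℂ)‖ = ideleNorm x ^ (-(1 / 2 : ℝ)) := by
  obtain ⟨σ, hσ⟩ := ψ.exists_norm_apply_eq_ideleNorm_rpow
  have h2 := HeckeCharacter.two_mul_exponent_eq_of_hasInfinityType h hσ (Classical.arbitrary (InfinitePlace K₁))
  have hσ' : σ = -(1 / 2 : ℝ) := by push_cast at h2; linarith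
  rw [hσ x, hσ']

/-- **HYPOTHESIS (L) OF THE KATZ–HSIEH SOCKET AT THE FRAME, from Deuring's theorem over `ℚ` and the socket's (T).** See the
module docstring. The conclusion is the binder `hLval` of `…KatzHsiehDisplay.exists_span_C_mul_eq` for
`lam := ψ.compRelNorm L * ν` with `cL = cL' = 1`. Hypotheses: `hSp` (p-adic CM type, as in the socket), `hT` (= the socket's (T)),
`hψ1`/`hψgood` (Deuring (i), (iv) for `ψ`), `hψbad` (`η` ramified above bad primes), `hf`, `hCM`, the biquadratic frame
(`h2K`, `h2L`, `τ`, `hτc`) and its side conditions `hdeg`, `hramL`, and `hν` (`ν = ‖·‖`).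
[cite: SilvermanATAEC1994, Ch. II Thm. 10.5 (b) and Ex. 2.30–2.32 (pp. 171–179)] [cite: Hsieh2014mu, Prop. 4.9 (§4.8)]
[cite: TateThesis1967, Thm. 4.4.1] -/
theorem hLval_of_deuring [IsTotallyComplex L] [IsCMField L] [IsTotallyComplex K] [IsTotallyComplex K₁] [IsGalois ℚ K₁]
    {p : ℕ} [Fact p.Prime] {ι : PadicAlgCl p ≃+* ℂ} {Sp : Finset (HeightOneSpectrum (𝓞 L))} (hSp : KatzCM.IsPAdicCMType p Sp)
    (W : WeierstrassCurve ℚ) [W.IsElliptic] [W.IsGloballyMinimal] [NeZero (W.conductorNorm ℤ)] (hCM : W.HasCM)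
    (c : K₁ ≃ₐ[ℚ] K₁) {ψ : HeckeCharacter K₁} (hψ1 : ψ.HasInfinityType (fun _ ↦ 1) (fun _ ↦ 0))
    (hψgood : ∀ (ℓ : ℕ) [Fact ℓ.Prime], W.HasGoodReductionAtPrime ℓ →
      ∀ 𝔮 : HeightOneSpectrum (𝓞 K₁), (ℓ : 𝓞 K₁) ∈ 𝔮.asIdeal →
        ψ.IsUnramifiedAt 𝔮 ∧
        (c • 𝔮 ≠ 𝔮 →
          ψ.valueAtUniformizer 𝔮 + ψ.valueAtUniformizer (c • 𝔮) = (W.frobeniusTrace ℓ : ℂ) ∧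
          ψ.valueAtUniformizer 𝔮 * ψ.valueAtUniformizer (c • 𝔮) = (ℓ : ℂ)) ∧
        (c • 𝔮 = 𝔮 → W.frobeniusTrace ℓ = 0 ∧ ψ.valueAtUniformizer 𝔮 = -(ℓ : ℂ)))
    (hψbad : ∀ (ℓ : ℕ) [Fact ℓ.Prime], ¬ W.HasGoodReductionAtPrime ℓ →
      ∀ w : HeightOneSpectrum (𝓞 L), (ℓ : 𝓞 L) ∈ w.asIdeal → ¬ (ψ.compRelNorm L).IsUnramifiedAt w)
    {f : CuspForm (Gamma0 (W.conductorNorm ℤ)) 2} (hf : IsNewformOf W f)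
    (h2K : Module.finrank ℚ K = 2) (h2L : Module.finrank K L = 2) {τ : L ≃ₐ[K] L} (hτ : τ ≠ 1)
    (hτc : (τ.restrictScalars ℚ).restrictNormal K₁ = c)
    (hdeg : ∀ (w : HeightOneSpectrum (𝓞 L)) (v : HeightOneSpectrum (𝓞 K)), w.under (𝓞 K) = v →
      w.asIdeal.inertiaDeg (𝓞 K) = 2 → Ideal.absNorm v.asIdeal = (Ideal.absNorm v.asIdeal).minFac)
    (hramL : ∀ (ℓ : ℕ) [Fact ℓ.Prime] (w : HeightOneSpectrum (𝓞 L)) (v : HeightOneSpectrum (𝓞 K)), w.under (𝓞 K) = v →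
      (ℓ : 𝓞 K) ∈ v.asIdeal → w.asIdeal.ramificationIdx (𝓞 K) = 2 → ¬ W.HasGoodReductionAtPrime ℓ)
    {ν : HeckeCharacter L} (hν : ∀ x : ideleGroup L, ((ν x : ℂˣ) : ℂ) = ((ideleNorm x : ℝ) : ℂ) ^ (1 : ℂ))
    {κ_ : ℕ → InfinitePlace L → ℕ}
    (hT : ∀ (χ : HeckeCharacter K) (n : ℕ), 0 < n → (∀ v : HeightOneSpectrum (𝓞 K), χ.IsUnramifiedAt v) →
      χ.HasInfinityType (fun _ ↦ (n : ℤ)) (fun _ ↦ -(n : ℤ)) →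
      KatzCM.HasKatzType ι Sp (ψ.compRelNorm L * ν * χ.compRelNorm L) 1 (κ_ n)) :
    ∀ (χ : HeckeCharacter K) (n : ℕ), 0 < n → (∀ v : HeightOneSpectrum (𝓞 K), χ.IsUnramifiedAt v) →
      χ.HasInfinityType (fun _ ↦ (n : ℤ)) (fun _ ↦ -(n : ℤ)) →
      ∀ hL : LFunction.HasEntireContinuation (heckeLFunction (ψ.compRelNorm L * ν * χ.compRelNorm L)),
        hL.continuation 0 = 1 * 1 ^ n * rankinSelbergValueHecke f χ 1 :=
  hLval_of_hasKatzType_of_heckeLFunction_eq hSp hT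
    (hEP_of_polynomial_identities' (norm_compRelNorm_apply ψ (norm_apply_eq_rpow_of_hasInfinityType_one_zero hψ1)) hν f
      (polynomial_identity W hCM c (norm_apply_eq_rpow_of_hasInfinityType_one_zero hψ1) hψgood hψbad hf h2K h2L hτ hτc
        hdeg hramL))

end Summit.BirchSwinnertonDyer.BirchSwinnertonDyer.Theorems.BiquadraticEisensteinDescentEisensteinHeartFlatCMInertBadKPrimeKatzHsiehLValue

end
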